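import Summits.Ventures.CertifiedQuantumChemistry.Rows.ExactRotationDevice
import Summits.Ventures.CertifiedQuantumChemistry.Rows.LinearCombination
import Mathlib.Analysis.CStarAlgebra.Matrix
import HarnessLib

/-!
# Ventures/CertifiedQuantumChemistry — Rows/TableDistanceTransport.lean: STATEMENTS (no proof obligation yet) of the
# «ROUNDED rotated table» TRANSPORT for the wave-4 LINE #1 «M3 × M5» (LINE 87f6ae85 §MECHANISM (E2) + (S); director-chem P13 (3);
# chem-lead g14 A37x (3)(b) ROUTING: «land your staged STATEMENT file … as statements (Prop + conditional theorems; the Prop's proof is the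
# LINE's later business)»; the critic's shapes (S2) Weyl / (S3) ℓ¹ op-norm control / (S5) composition, INBOX l.6062 (B))

HONEST FRAMING (verbatim): certified bounds for a stated model Hamiltonian in a stated basis; not a
claim about the real molecule or material beyond that model. This file certifies NO number and PROVES no
new analysis: §1 defines the exact-rational TABLE DISTANCE `Model.tableDist` and STATES the op-norm table
Lipschitz bound (E2) as a named `Prop` (`Model.EnergyTableLipschitz`, OPEN here — to be proved in a sibling
file from `toSpin_hamiltonian_eq_sum_rawTerms` + `‖a†‖, ‖a‖ ≤ 1` + the l2-op-norm Lipschitz property of the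
sector minimum); §2 proves the 5-line ROW TRANSPORTS (S) that a «F″ = round(rotate u F)» certificate device
needs, CONDITIONAL on (E2) as an explicit hypothesis — exactly the row shape a future CERTIFIED-CHEM row on the
CENSUS key of F would instantiate (its Lean cell takes `(hE2 : Model.EnergyTableLipschitz)` until the sibling
proof lands, then drops it).

THE MECHANISM (LINE §MECHANISM, quoted): (E1) for an EXACT ORBITAL ROTATION `u` (`uᵀu = 1` over ℚ,
`Model.IsExactOrbitalRotation`) `E₀(rotate u F; a, b) = E₀(F; a, b)` — in tree (`Model.energy_rotate`,
`lowerRow_rotate_iff`); (E2) TABLE-LEVEL LIPSCHITZ: for two tables on the same `k` and sector,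
`|E₀(F′; a, b) − E₀(F″; a, b)| ≤ ‖Ĥ(F′) − Ĥ(F″)‖_op ≤ ε_rd(F′, F″) := |δE_core| + 2·Σ_pq |δh_pq| + 2·Σ_pqrs |δ(pq|rs)|`
(the factor 2 = the two spins on the one-body term `Σ_σ a†_{pσ} a_{qσ}`; on the two-body term ½·Σ_{στ} = 2 with
`‖a†a†aa‖ ≤ 1`; `Model.hamiltonian` = `E_core·1 + Σ h a†a + ½ Σ (pq|rs) a†a†aa`, Statement.lean); the in-tree
ENTRY-SUM bound `abs_sectorGroundEnergy_sub_le` (Σ_st ‖Ĥ_st − Ĥ′_st‖, Rows/SectorEnergyConcavity.lean) is too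
weak for the device (≈ 2 E_h on a k = 24 file) — the op-norm form is the needed one; (S) TRANSPORT: a certified
`LowerRow F″ a b lo` on the DERIVED rounded rotated table F″ with `tableDist (rotate u F) F″ ≤ ε` gives
`LowerRow F a b (lo − ε)` on the CENSUS key; the same for a LEVEL-SHIFTED leg when the weight file is
`u`-invariant (block-diagonal frames: `rotate u W = W`), so that «no new β leg» is needed (LINE §DOOR).

WHAT THIS IS NOT: not a proof of (E2); not a certificate; not a row; no new axiom (the open statement is a
`def … : Prop`, never asserted); typed by chem-type-07 (B8-1 slot 07, gen 12) as the pre-drafted STATEMENT the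
chair routed conditionally on the FRAME-SCAN KEEP.
-/

noncomputable section

namespace Summit.Ventures.CertifiedQuantumChemistry

open Matrix Finset

variable {k : ℕ}

/-! ## §1 The exact table distance and the (E2) statement -/

/-- **The exact-rational TABLE DISTANCE** `ε_rd(F, G) := |E_core(F) − E_core(G)| + 2·Σ_pq |h_pq(F) − h_pq(G)| +
2·Σ_pqrs |(pq|rs)_F − (pq|rs)_G|` (LINE 87f6ae85 §MECHANISM (E2); a rational number a referee re-derives from two
pinned tables and prints UP). -/
def Model.tableDist (F G : Model k) : ℚ :=
  |F.ecore - G.ecore| + 2 * ∑ p, ∑ q, |F.h p q - G.h p q| +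
    2 * ∑ p, ∑ q, ∑ r, ∑ s, |F.eri p q r s - G.eri p q r s|

/-- The table distance is symmetric. -/
theorem Model.tableDist_comm (F G : Model k) : Model.tableDist F G = Model.tableDist G F := by
  simp only [Model.tableDist, abs_sub_comm]

/-- The table distance is nonnegative. -/
theorem Model.tableDist_nonneg (F G : Model k) : 0 ≤ Model.tableDist F G := by
  unfold Model.tableDist
  positivity

/-- **(E2) TABLE-LEVEL LIPSCHITZ — THE OPEN STATEMENT (a `Prop`, nothing asserted).** For every `k`, every two
model files `F G : Model k` and every physical sector `a, b ≤ k`: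
`|E₀(F; a, b) − E₀(G; a, b)| ≤ ε_rd(F, G)` (`Model.energy`, `Model.tableDist`). Route of proof (sibling file, M-size,
chem-type-07 estimate INBOX l.5789): `Ĥ_F − Ĥ_G = (δE_core)·1 + Σ δh a†a + ½ Σ δ(pq|rs) a†a†aa` termwise
(`toSpin_hamiltonian_eq_sum_rawTerms`, Rows/HamiltonianTermList.lean), `‖a†_{pσ}‖, ‖a_{qσ}‖ ≤ 1`
(`norm_creation_le_one` / `norm_annihilation_le_one`, l2 operator norm), hence `‖Ĥ_F − Ĥ_G‖ ≤ ε_rd`; and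
`|min_{ψ ∈ sector, ‖ψ‖ = 1} Re⟨ψ, Ĥψ⟩ − min Re⟨ψ, Ĥ′ψ⟩| ≤ ‖Ĥ − Ĥ′‖` (Weyl for the bottom of a compression).
No symmetry hypothesis is needed (the sector minimum of the real part of the quadratic form is Lipschitz for any
matrix). [cite: HornJohnson2013, Thm 4.3.1] -/
def Model.EnergyTableLipschitz : Prop :=
  ∀ (k : ℕ) (F G : Model k) (a b : ℕ), a ≤ k → b ≤ k →
    |F.energy a b - G.energy a b| ≤ ((Model.tableDist F G : ℚ) : ℝ)

open scoped Matrix.Norms.L2Operator in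
/-- **(S3) ℓ¹ OPERATOR-NORM CONTROL — OPEN STATEMENT (a `Prop`, nothing asserted)** (critic l.6062 (B) (S3)): on the finite-dimensional
Fock space the second-quantised Hamiltonians of two tables differ in l2-OPERATOR norm by at most the table distance,
`‖Ĥ_F − Ĥ_G‖ ≤ ε_rd(F, G)` — each `a†_{pσ}a_{qσ}` / `a†a†aa` monomial has norm ≤ 1 (`norm_creation_le_one`, `norm_annihilation_le_one`),
summed with the coefficients `|δh|`, `½|δ(pq|rs)|` over the spin labels (`toSpin_hamiltonian_eq_sum_rawTerms`). [cite: HornJohnson2013, Thm 4.3.1] -/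
def Model.OpNormTableBound : Prop :=
  ∀ (k : ℕ) (F G : Model k), ‖F.hamiltonian - G.hamiltonian‖ ≤ ((Model.tableDist F G : ℚ) : ℝ)

open scoped Matrix.Norms.L2Operator in
/-- **(S2) WEYL FOR THE SECTOR MINIMUM — OPEN STATEMENT (a `Prop`, nothing asserted)** (critic l.6062 (B) (S2), the `j = 0` case the LOWER
transport needs): for any two matrices on the Fock space of `k` orbitals and a physical sector `a, b ≤ k`,
`|E₀(H; a, b) − E₀(H′; a, b)| ≤ ‖H − H′‖` (l2 operator norm; the sector minimum of `Re⟨ψ, ·ψ⟩` over unit `ψ` is 1-Lipschitz). The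
in-tree `abs_sectorGroundEnergy_sub_le` is the ENTRY-SUM version (Σ_st ‖H_st − H′_st‖); this is its op-norm sharpening. The
`j`-indexed form (every sorted eigenvalue is 1-Lipschitz) is NOT what the β leg uses here: the spectral `GapCertificate` does not
transport under perturbation when `E₀` is degenerate — the β leg is transported as a LEVEL-SHIFT ROW instead
(`lowerRow_levelShift_of_exactRotation_round` below, then the in-tree `gapCertificateCodimOne_of_lowerRow_levelShift[_thresholds]` ON F″).
[cite: HornJohnson2013, Thm 4.3.1] -/
def Model.SectorEnergyOpNormLipschitz : Prop :=
  ∀ (k : ℕ) (H H' : Matrix (Finset (Literature.MathematicalPhysics.QuantumLattice.Orb (Fin k)))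
      (Finset (Literature.MathematicalPhysics.QuantumLattice.Orb (Fin k))) ℂ) (a b : ℕ), a ≤ k → b ≤ k →
    |Literature.MathematicalPhysics.QuantumChemistry.sectorGroundEnergy H a b -
        Literature.MathematicalPhysics.QuantumChemistry.sectorGroundEnergy H' a b| ≤ ‖H - H'‖

open scoped Matrix.Norms.L2Operator in
/-- (S2) ∧ (S3) ⇒ (E2): the table-Lipschitz statement is the composition of the two open statements (so the LINE may prove
either the pair or (E2) directly). -/
theorem Model.energyTableLipschitz_of (hS2 : Model.SectorEnergyOpNormLipschitz) (hS3 : Model.OpNormTableBound) :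
    Model.EnergyTableLipschitz := by
  intro k F G a b ha hb
  have h2 := hS2 k F.hamiltonian G.hamiltonian a b ha hb
  have h3 := hS3 k F G
  unfold Model.energy
  exact h2.trans h3

/-! ## §2 The row transports (S), conditional on (E2) -/

/-- **LOWER rows transport across a table distance** (conditional on (E2)): `LowerRow G a b lo` and
`tableDist F G ≤ ε` give `LowerRow F a b (lo − ε)`. -/
theorem LowerRow.of_tableDist (hE2 : Model.EnergyTableLipschitz) {F G : Model k} {a b : ℕ} {lo ε : ℚ}
    (h : LowerRow G a b lo) (hd : Model.tableDist F G ≤ ε) : LowerRow F a b (lo - ε) := by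
  obtain ⟨ha, hb, hle⟩ := h
  refine ⟨ha, hb, ?_⟩
  have hL := hE2 k F G a b ha hb
  have hd' : ((Model.tableDist F G : ℚ) : ℝ) ≤ ((ε : ℚ) : ℝ) := by exact_mod_cast hd
  rw [abs_le] at hL
  push_cast
  linarith [hL.1]

/-- **UPPER rows transport across a table distance** (conditional on (E2)): `UpperRow G a b hi` and
`tableDist F G ≤ ε` give `UpperRow F a b (hi + ε)`. -/
theorem UpperRow.of_tableDist (hE2 : Model.EnergyTableLipschitz) {F G : Model k} {a b : ℕ} {hi ε : ℚ}
    (h : UpperRow G a b hi) (hd : Model.tableDist F G ≤ ε) : UpperRow F a b (hi + ε) := by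
  obtain ⟨ha, hb, hle⟩ := h
  refine ⟨ha, hb, ?_⟩
  have hL := hE2 k F G a b ha hb
  have hd' : ((Model.tableDist F G : ℚ) : ℝ) ≤ ((ε : ℚ) : ℝ) := by exact_mod_cast hd
  rw [abs_le] at hL
  push_cast
  linarith [hL.2]

/-- **(S) THE DEVICE'S ROW: exact rotation + rounded table.** For an EXACT orbital rotation `u` (`uᵀu = 1` over
ℚ), a DERIVED table `F″` with `tableDist (rotate u F) F″ ≤ ε` (the exact rational re-rounding distance, printed
UP), and a certified `LowerRow F″ a b lo` (e.g. a Temple row on F″): `LowerRow F a b (lo − ε)` on the CENSUS key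
of `F` — `E₀(F) = E₀(rotate u F) ≥ E₀(F″) − ε ≥ lo − ε` ((E1) `lowerRow_rotate_iff` + (E2)). Conditional on (E2).
[cite: HelgakerJorgensenOlsen2000, eq. (3.2.1)] -/
theorem lowerRow_of_exactRotation_round (hE2 : Model.EnergyTableLipschitz) {u : Matrix (Fin k) (Fin k) ℚ}
    (hu : Model.IsExactOrbitalRotation u) {F F'' : Model k} {a b : ℕ} {lo ε : ℚ}
    (hd : Model.tableDist (Model.rotate u F) F'' ≤ ε) (h : LowerRow F'' a b lo) :
    LowerRow F a b (lo - ε) :=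
  (lowerRow_rotate_iff hu F a b (lo - ε)).1 (LowerRow.of_tableDist hE2 h hd)

/-- The UPPER twin of (S): `UpperRow F″ a b hi`, `tableDist (rotate u F) F″ ≤ ε` ⇒ `UpperRow F a b (hi + ε)`.
Conditional on (E2). [cite: HelgakerJorgensenOlsen2000, eq. (3.2.1)] -/
theorem upperRow_of_exactRotation_round (hE2 : Model.EnergyTableLipschitz) {u : Matrix (Fin k) (Fin k) ℚ}
    (hu : Model.IsExactOrbitalRotation u) {F F'' : Model k} {a b : ℕ} {hi ε : ℚ}
    (hd : Model.tableDist (Model.rotate u F) F'' ≤ ε) (h : UpperRow F'' a b hi) :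
    UpperRow F a b (hi + ε) :=
  (upperRow_rotate_iff hu F a b (hi + ε)).1 (UpperRow.of_tableDist hE2 h hd)

/-- **The table distance is blind to a common additive table**: `tableDist (lincomb 1 c F W) (lincomb 1 c G W) = tableDist F G`
— so a LEVEL-SHIFTED leg `F″ + λ·W` is exactly as far from `rotate u F + λ·W` as `F″` is from `rotate u F`
(the «no new β leg» bookkeeping of LINE §DOOR when the weight file `W` is `u`-invariant). -/
theorem Model.tableDist_lincomb_right (F G W : Model k) (c : ℚ) :
    Model.tableDist (Model.lincomb 1 c F W) (Model.lincomb 1 c G W) = Model.tableDist F G := by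
  simp only [Model.tableDist, Model.lincomb_h, Model.lincomb_eri, Model.lincomb_ecore, one_mul, add_sub_add_right_eq_sub]


/-! ## §3 The β leg: transport of a LEVEL-SHIFT lower row to the rounded rotated file (S5, «no new β leg») -/

/-- **LEVEL-SHIFT LOWER ROW TRANSPORT** (conditional on (E2)): let `u` be an exact orbital rotation that FIXES the weight file `W`
(`rotate u W = W` — a block-diagonal frame on the reference/threshold blocks of `Model.diagWeight w μ`), `F″` a table with
`tableDist (rotate u F) F″ ≤ ε`, and `LowerRow (lincomb 1 λ F W) a b ℓ` the certified β leg ON THE CENSUS MODEL (e.g. rows #321 / #322).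
Then `LowerRow (lincomb 1 λ F″ W) a b (ℓ − ε)` — the β leg OF THE ROUNDED ROTATED FILE, from which the in-tree
`gapCertificateCodimOne_of_lowerRow_levelShift_thresholds` / `…_closedShell` produce the `GapCertificate F″ a b (…)` a Temple row ON F″
consumes. Proof: `rotate u (lincomb 1 λ F W) = lincomb 1 λ (rotate u F) W` (`Model.rotate_lincomb` + `rotate u W = W`), rotation
invariance (`lowerRow_rotate_iff`), and `tableDist (lincomb 1 λ F″ W) (lincomb 1 λ (rotate u F) W) = tableDist F″ (rotate u F) ≤ ε`
(`Model.tableDist_lincomb_right`, `Model.tableDist_comm`). [cite: HelgakerJorgensenOlsen2000, eq. (3.2.1)] -/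
theorem lowerRow_levelShift_of_exactRotation_round (hE2 : Model.EnergyTableLipschitz)
    {u : Matrix (Fin k) (Fin k) ℚ} (hu : Model.IsExactOrbitalRotation u) {F F'' W : Model k}
    (hW : Model.rotate u W = W) {lam : ℚ} {a b : ℕ} {ℓ ε : ℚ}
    (hd : Model.tableDist (Model.rotate u F) F'' ≤ ε) (h : LowerRow (Model.lincomb 1 lam F W) a b ℓ) :
    LowerRow (Model.lincomb 1 lam F'' W) a b (ℓ - ε) := by
  have hrot : LowerRow (Model.lincomb 1 lam (Model.rotate u F) W) a b ℓ := by
    have := (lowerRow_rotate_iff hu (Model.lincomb 1 lam F W) a b ℓ).2 h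
    rwa [Model.rotate_lincomb, hW] at this
  refine LowerRow.of_tableDist hE2 hrot ?_
  rw [Model.tableDist_lincomb_right, Model.tableDist_comm]
  exact hd

end Summit.Ventures.CertifiedQuantumChemistry

end
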